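import Summits.Parity.GeneralizedHardyLittlewood.Theses.EntropyRate
import Summits.Parity.GeneralizedHardyLittlewood.Cruxes.UniformEntropyRate.CruxAttackGen1
import Literature.NumberTheory.Multiplicative.LiouvilleBlockEntropyIterate

/-!
# Strategy census r1 — companion file for crux `EntropyRate.UniformEntropyRate` (stmt-Parity-17876)

Crux-strategist REDIRECT r1 (`cstrat-stmt-Parity-17876-r1`). Zero `sorry`. This file TYPES the doors
discussed in `STRATEGY-CENSUS.md` and PROVES the two facts the verdict rests on:

* `doorSwapped` — the door with the quantifiers `∃ H` / `∀ X` SWAPPED is a THEOREM (telescoping of the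
  entropy rate along `H₁·k^j` + `0 ≤ h ≤ log 2` + divergence of the harmonic series; no number theory):
  for every `ε, k ≥ 2, H₁` there is a finite window `[H₁, H₂]` such that EVERY scale `X` has a good `H`
  in the window. Hence the ONLY content of the crux is UNIFORMITY OF THE GOOD SCALE `H` IN `X`
  (Tao 2016, p. 9 / p. 15: "the scale `H` cannot be specified in advance"), i.e. exactly what the
  catalogued barrier `Literature.Barriers.Parity.LogarithmicAveraging{,Scope}` is about.
* `scalePersistence_iff` — the complementary piece of the only non-shredding split through
  `doorSwapped` ("a window-good-for-every-X upgrades to one H good for all large X") is the crux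
  itself (kernel: `ScalePersistence ↔ UniformEntropyRate`), so that split is not a decomposition.

It also records, as `def`s only (no claims proved about them):
* `EntropyTransferLogK` — the consumer correctly typed: what `EntropyTransfer` can actually be proved
  for is the refuter's re-typed door `Attack.UniformEntropyRateLogK` (k = ⌈log² H⌉, CruxAttackGen1),
  not the fixed-`k` door; and that re-typed door already yields `ChowlaFixed` (natural-density binary
  Chowla at every shift — item stmt-Parity-17879, a named open problem).
* `DiagonalDoor` — the "local in scale" door examined under Transfer/Decomposition (good `H_m` only for
  `X` in a dyadic block attached to `m`): what a second pigeonhole over scales gives is the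
  almost-all-scales shape of Tao–Teräväinen 2019 §5, not this.
-/

set_option linter.dupNamespace false

noncomputable section

open scoped BigOperators Topology
open Filter

namespace Summit.Parity.GeneralizedHardyLittlewood.Cruxes.UniformEntropyRate.StrategyCensusR1

open Summit.Parity.GeneralizedHardyLittlewood.Theses.EntropyRate
  (UniformEntropyRate ChowlaFixed PrimeLagChowla EntropyTransfer)
open Summit.Parity.GeneralizedHardyLittlewood.Cruxes.UniformEntropyRate.Attack (UniformEntropyRateLogK)
open Literature.NumberTheory.Multiplicative
  (liouvilleBlockEntropyRate liouvilleBlockEntropyRate_nonneg liouvilleBlockEntropyRate_le_log_two)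

/-! ## The crux read through the Literature rate `h_X(M) = liouvilleBlockEntropyRate X M` -/

/-- The route decl, verbatim, is the statement about `Literature…liouvilleBlockEntropyRate`
(definitional: the route's `let freq / ent` are `liouvilleBlockFreq / liouvilleBlockEntropy`). -/
theorem uniformEntropyRate_iff_lit :
    UniformEntropyRate ↔
      ∀ ε : ℝ, 0 < ε → ∀ k : ℕ, 2 ≤ k → ∀ H₁ : ℕ, ∃ H : ℕ, H₁ ≤ H ∧ 2 ≤ H ∧ ∃ X₀ : ℕ, ∀ X : ℕ,
        X₀ ≤ X → liouvilleBlockEntropyRate X H - liouvilleBlockEntropyRate X (k * H)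
          ≤ ε / Real.log H :=
  Iff.rfl

/-! ## (1) The door with `∃ H` and `∀ X` swapped is a theorem -/

/-- **The swapped door.** For every `ε > 0`, `k ≥ 2`, `H₁` there is `H₂` such that for EVERY scale `X`
some `H ∈ [max(H₁,2), H₂]` has entropy-rate decrement `h_X(H) − h_X(kH) ≤ ε / log H`. -/
def DoorSwapped : Prop :=
  ∀ ε : ℝ, 0 < ε → ∀ k : ℕ, 2 ≤ k → ∀ H₁ : ℕ, ∃ H₂ : ℕ, ∀ X : ℕ, ∃ H : ℕ, H₁ ≤ H ∧ 2 ≤ H ∧ H ≤ H₂ ∧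
    liouvilleBlockEntropyRate X H - liouvilleBlockEntropyRate X (k * H) ≤ ε / Real.log H

/-- **Finite harmonic pigeonhole** (uniform in the sequence). Given `B` and `ε, C > 0` there is `n`
such that every sequence `r ≥ 0` with `r 0 ≤ B` has a step `j < n` with drop
`r j − r (j+1) ≤ ε / ((j+1) C)`. [folklore: divergence of the harmonic series] -/
theorem exists_small_drop_uniform (B : ℝ) {ε C : ℝ} (hε : 0 < ε) (hC : 0 < C) :
    ∃ n : ℕ, ∀ r : ℕ → ℝ, (∀ j, 0 ≤ r j) → r 0 ≤ B →
      ∃ j, j < n ∧ r j - r (j + 1) ≤ ε / (((j : ℝ) + 1) * C) := by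
  have hdiv : Tendsto (fun n : ℕ => ε / C * ∑ i ∈ Finset.range n, (1 / ((i : ℝ) + 1))) atTop atTop :=
    (Real.tendsto_sum_range_one_div_nat_succ_atTop).const_mul_atTop (div_pos hε hC)
  obtain ⟨n, hn⟩ := (Filter.tendsto_atTop.mp hdiv (B + 1)).exists
  refine ⟨n, fun r hr0 hrB => ?_⟩
  by_contra hcon
  simp only [not_exists, not_and, not_le] at hcon
  -- hcon : ∀ j, j < n → ε / ((↑j + 1) * C) < r j - r (j + 1)
  have hsum : ε / C * ∑ i ∈ Finset.range n, (1 / ((i : ℝ) + 1)) ≤ r 0 - r n := by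
    calc ε / C * ∑ i ∈ Finset.range n, (1 / ((i : ℝ) + 1))
        = ∑ i ∈ Finset.range n, ε / C * (1 / ((i : ℝ) + 1)) := Finset.mul_sum _ _ _
      _ = ∑ i ∈ Finset.range n, ε / (((i : ℝ) + 1) * C) := by
          refine Finset.sum_congr rfl fun i _ => ?_
          rw [div_mul_div_comm, mul_one, mul_comm C]
      _ ≤ ∑ i ∈ Finset.range n, (r i - r (i + 1)) :=
          Finset.sum_le_sum fun i hi => (hcon i (Finset.mem_range.mp hi)).le
      _ = r 0 - r n := Finset.sum_range_sub' r n
  linarith [hr0 n]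

/-- **`DoorSwapped` holds** — telescoping along the chain `M_j = k^j · max(H₁,2)`, `0 ≤ h_X ≤ log 2`
(`liouvilleBlockEntropyRate_nonneg/_le_log_two`), `log M_j ≤ (j+1) log(k M₀)`, and
`exists_small_drop_uniform`. No property of λ beyond `h_X(M) ∈ [0, log 2]` is used. -/
theorem doorSwapped : DoorSwapped := by
  intro ε hε k hk H₁
  obtain ⟨M₀, hM₀H, hM₀2⟩ : ∃ M₀ : ℕ, H₁ ≤ M₀ ∧ 2 ≤ M₀ := ⟨max H₁ 2, le_max_left _ _, le_max_right _ _⟩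
  have hk1 : 1 ≤ k := le_trans (by norm_num) hk
  have hkpos : 0 < k := hk1
  obtain ⟨M, hM⟩ : ∃ M : ℕ → ℕ, ∀ j, M j = k ^ j * M₀ := ⟨fun j => k ^ j * M₀, fun _ => rfl⟩
  have hMsucc : ∀ j, M (j + 1) = k * M j := by
    intro j
    rw [hM, hM, pow_succ]
    ring
  have hMge : ∀ j, M₀ ≤ M j := by
    intro j
    rw [hM]
    exact Nat.le_mul_of_pos_left M₀ (pow_pos hkpos j)
  have hMmono : ∀ i j, i ≤ j → M i ≤ M j := by
    intro i j hij
    rw [hM, hM]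
    exact Nat.mul_le_mul_right M₀ (Nat.pow_le_pow_right hkpos hij)
  have hM2 : ∀ j, 2 ≤ M j := fun j => hM₀2.trans (hMge j)
  -- `0 < log (M j) ≤ (j + 1) * log (k * M₀)`
  have hlogpos : ∀ j, 0 < Real.log (M j) := fun j =>
    Real.log_pos (by exact_mod_cast (lt_of_lt_of_le (by norm_num) (hM2 j) : 1 < M j))
  have hC : 0 < Real.log ((k * M₀ : ℕ) : ℝ) := by
    apply Real.log_pos
    have h4 : 2 * 2 ≤ k * M₀ := Nat.mul_le_mul hk hM₀2
    exact_mod_cast (lt_of_lt_of_le (by norm_num) h4 : 1 < k * M₀)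
  have hlogle : ∀ j, Real.log (M j) ≤ ((j : ℝ) + 1) * Real.log ((k * M₀ : ℕ) : ℝ) := by
    intro j
    have hnat : M j ≤ (k * M₀) ^ (j + 1) := by
      rw [hM, mul_pow]
      exact Nat.mul_le_mul (Nat.pow_le_pow_right hkpos (Nat.le_succ j))
        (le_self_pow₀ (le_trans (by norm_num) hM₀2) (Nat.succ_ne_zero j))
    have hreal : (M j : ℝ) ≤ ((k * M₀ : ℕ) : ℝ) ^ (j + 1) := by exact_mod_cast hnat
    have hpos : (0 : ℝ) < (M j : ℝ) := by
      exact_mod_cast (lt_of_lt_of_le (by norm_num) (hM2 j) : 0 < M j)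
    calc Real.log (M j) ≤ Real.log (((k * M₀ : ℕ) : ℝ) ^ (j + 1)) := Real.log_le_log hpos hreal
      _ = ((j + 1 : ℕ) : ℝ) * Real.log ((k * M₀ : ℕ) : ℝ) := Real.log_pow _ _
      _ = ((j : ℝ) + 1) * Real.log ((k * M₀ : ℕ) : ℝ) := by push_cast; ring
  -- the uniform pigeonhole, with `B = log 2`
  obtain ⟨n, hn⟩ := exists_small_drop_uniform (Real.log 2) hε hC
  refine ⟨M n, fun X => ?_⟩
  obtain ⟨j, hjn, hj⟩ := hn (fun j => liouvilleBlockEntropyRate X (M j))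
    (fun j => liouvilleBlockEntropyRate_nonneg X (M j)) (liouvilleBlockEntropyRate_le_log_two X (M 0))
  refine ⟨M j, hM₀H.trans (hMge j), hM2 j, hMmono j n hjn.le, ?_⟩
  have hstep : ε / (((j : ℝ) + 1) * Real.log ((k * M₀ : ℕ) : ℝ)) ≤ ε / Real.log (M j) :=
    div_le_div_of_nonneg_left hε.le (hlogpos j) (hlogle j)
  have hj' : liouvilleBlockEntropyRate X (M j) - liouvilleBlockEntropyRate X (M (j + 1))
      ≤ ε / (((j : ℝ) + 1) * Real.log ((k * M₀ : ℕ) : ℝ)) := hj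
  rw [hMsucc] at hj'
  exact hj'.trans hstep

/-! ## (2) The complementary piece of the split through `doorSwapped` is the crux itself -/

/-- **Scale persistence** — "a finite window of scales good for EVERY `X` upgrades to ONE scale good
for all large `X`": the piece that would complete the split `DoorSwapped ∧ ScalePersistence → crux`. -/
def ScalePersistence : Prop := DoorSwapped → UniformEntropyRate

/-- The split through the swapped door is not a decomposition: its open piece IS the crux. -/
theorem scalePersistence_iff : ScalePersistence ↔ UniformEntropyRate :=
  ⟨fun h => h doorSwapped, fun h _ => h⟩

/-! ## (3) Typed doors recorded for the census (definitions only) -/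

/-- **The consumer, correctly typed.** `EntropyTransfer` (item stmt-Parity-17880, labelled "support,
provable now, XL") is `PrimeLagChowla → UniformEntropyRate → ChowlaFixed`; Tao's inequality (3.12)
`I(X_H;Y_H) ≤ H·[h(H) − h(kH)] + H(Y_H)/k` with `H(Y_H) ≍ ε²H` and the Tao–Teräväinen §5 requirement
`I ≤ ε⁵ H / log H` force `k ≫ log H / ε³`, so what the printed argument proves is THIS statement, over
the refuter's re-typed door `UniformEntropyRateLogK` (k = ⌈log² H⌉), not `EntropyTransfer` as filed.
[cite: arXiv:1509.05422 §3 (3.12); arXiv:1809.02518 §5 Prop. 5.1] -/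
def EntropyTransferLogK : Prop := PrimeLagChowla → UniformEntropyRateLogK → ChowlaFixed

/-- **The diagonal (scale-local) door**: good scales `H` attached to dyadic ranges of `X` only —
for every `ε, k` there are `m₋ ≤ m₊` such that every large `X` admits SOME `m ∈ [m₋, m₊]` with
`h_X(2^m) − h_X(k·2^m) ≤ ε / log 2^m`. This is `doorSwapped` restricted to dyadic `H` (so again a
theorem-shaped statement, uniform window, `H` depending on `X`); a second pigeonhole over `X` in
logarithmic scale only makes the exceptional `(X, m)` pairs sparse in logarithmic density — the
almost-all-scales output of Tao–Teräväinen 2019 §5 — and never removes the dependence of `m` on `X`.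
Recorded to document the Transfer/Decomposition attempts; nothing is claimed about it here.
[cite: arXiv:1809.02518 §5 (Prop. 5.1: "there exist arbitrarily large m"), Rem. 1.11] -/
def DiagonalDoor : Prop :=
  ∀ ε : ℝ, 0 < ε → ∀ k : ℕ, 2 ≤ k → ∀ m₁ : ℕ, ∃ m₂ : ℕ, ∃ X₀ : ℕ, ∀ X : ℕ, X₀ ≤ X →
    ∃ m : ℕ, m₁ ≤ m ∧ 1 ≤ m ∧ m ≤ m₂ ∧
      liouvilleBlockEntropyRate X (2 ^ m) - liouvilleBlockEntropyRate X (k * 2 ^ m)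
        ≤ ε / Real.log ((2 ^ m : ℕ) : ℝ)

end Summit.Parity.GeneralizedHardyLittlewood.Cruxes.UniformEntropyRate.StrategyCensusR1

end
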